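import Literature.Combinatorics.Sahi2008.Functional
import Mathlib.Combinatorics.SetFamily.FourFunctions
import HarnessLib

/-!
# Push-forwards of weights, coin (product) weights on finite cubes, threshold coins

CITATION HEADER.  Source: J. Kahn, *A note on positive association*, arXiv:2210.08653 (2022)
[Kahn2022], p. 2 ("Underlying independents. One way to prove PA for `μ` is to realize the `X_i`'s as
increasing functions of independent Bernoullis `Y_1,…,Y_m` and invoke Harris … Say `μ` is FUI (for
finitely many underlying independents) in the first case") and footnote 1 there (R. van den Berg's
sketch that FKG measures are FUI: "(b) For each `i`, the procedure in (a) depends on a finite number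
of events `A(i,j) := {Z_i > α_{i,j}}`, and it's easy to realize the indicators `1_{A(i,j)}` … as
nondecreasing functions of independent (nonidentical) Bernoullis `Y_{i,j}`"); read 2026-08-19 from the
materialised arXiv text (`lit read arxiv:2210.08653`, pp. 1–3).  Companion vocabulary:
`Literature/Combinatorics/Sahi2008/Functional.lean` (`ex`, `sahiE`, `SahiPositive`, `IsFKGMeasure`).

This file is the PLUMBING for `Sahi2008/UnderlyingIndependents.lean` (Kahn's footnote: every FKG
weight is the law of a monotone image of finitely many independent coins), kept separate so that
each file stays small.  Everything here is elementary and PROVED; there is no named fact.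

## Contents

* `pushWeight w G` — the law of `G` under the weight `w` (`c ↦ Σ_{b : G b = c} w b`); expectations
  (`ex_pushWeight`: `E_{G_* w}[h] = E_w[h ∘ G]`), total mass, functoriality, the value on the range of
  an injective map / along a bijection, and the two facts the Sahi programme uses:
  `sahiE_pushWeight` (`E_n^{G_* w}(f) = E_n^{w}(f ∘ G)`, the functional only sees expectations of
  products — the same observation as `Literature.Probability.Percolation.BHK2006.sahiE_eq_of_ex_eq`,
  here for the explicit push-forward) and `SahiPositive.of_pushWeight` (Sahi positivity of order `n`
  passes to the push-forward along a MONOTONE map — Kahn's "realize … as increasing functions … and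
  invoke Harris", for every order `n`); `isFKGMeasure_pushWeight` (the FKG lattice condition passes
  along an injective `⊓`/`⊔`-preserving map, the zero extension).
* `coinWeight q` — the product weight of independent coins `P(Y_i = 1) = q_i` on the cube `ι → Bool`
  (Sahi's product measure (2) [Sahi2008, p. 210] in Boolean coordinates): positivity, total mass `1`,
  splitting along `Fin.append`, and the marginal identity
  `P(Y_i = 1 ∀ i ∈ S) = Π_{i∈S} q_i` (`sum_coinWeight_forall`).
* THRESHOLD COINS (footnote 1 (b)): for a finite set `C ⊂ (0,1)` of target probabilities, enumerated
  decreasingly `v_0 > v_1 > ⋯` (`decEnum`), the coins `q_0 = v_0`, `q_{j+1} = v_{j+1}/v_j` (`ratioCoin`)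
  realise every `v_j` as the probability of the increasing event "`Y_i = 1` for all `i ≤ j`"
  (`prod_range_ratioCoin`, `sum_coinWeight_prefix`).
-/

noncomputable section

namespace Literature.Combinatorics.Sahi2008

open Finset

/-! ### Push-forward of a weight along a map -/

section PushForward

variable {β γ δ : Type*} [Fintype β]

open Classical in
/-- The **push-forward** (law of `G`) of the weight `w` along `G : β → γ`:
`(G_* w)(c) = Σ_{b : G b = c} w(b)` — "the law of `(X_1,…,X_n)`" when the `X`'s are functions `G` of
underlying variables with law `w`. [cite: Kahn2022, p. 2 (Underlying independents)] -/
def pushWeight (w : β → ℝ) (G : β → γ) (c : γ) : ℝ := ∑ b, if G b = c then w b else 0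

/-- Unfolding `pushWeight` with any decidability instance. [cite: Kahn2022, p. 2 (Underlying independents)] -/
theorem pushWeight_apply [DecidableEq γ] (w : β → ℝ) (G : β → γ) (c : γ) :
    pushWeight w G c = ∑ b, if G b = c then w b else 0 := by
  rw [pushWeight]
  exact sum_congr rfl fun b _ => by congr

/-- `(G_* w)(c) = E_w[1_{G = c}]`. [cite: Kahn2022, p. 2 (Underlying independents)] -/
theorem pushWeight_eq_ex [DecidableEq γ] (w : β → ℝ) (G : β → γ) (c : γ) :
    pushWeight w G c = ex w (fun b => if G b = c then 1 else 0) := by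
  rw [pushWeight_apply, ex]
  refine sum_congr rfl fun b _ => ?_
  split_ifs <;> simp

/-- **Expectations under a push-forward**: `E_{G_* w}[h] = E_w[h ∘ G]`.
[cite: Kahn2022, p. 2 (Underlying independents)] -/
theorem ex_pushWeight [Fintype γ] (w : β → ℝ) (G : β → γ) (h : γ → ℝ) :
    ex (pushWeight w G) h = ex w (h ∘ G) := by
  classical
  simp only [ex, pushWeight_apply, sum_mul, Function.comp_apply]
  rw [sum_comm]
  refine sum_congr rfl fun b _ => ?_
  simp only [ite_mul, zero_mul]
  rw [sum_ite_eq, if_pos (mem_univ _)]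

/-- The push-forward has the same total mass. [cite: Kahn2022, p. 2 (Underlying independents)] -/
theorem sum_pushWeight [Fintype γ] (w : β → ℝ) (G : β → γ) : ∑ c, pushWeight w G c = ∑ b, w b := by
  have h := ex_pushWeight w G (fun _ => 1)
  simpa only [ex, mul_one, Function.comp_def] using h

/-- The push-forward of a nonnegative weight is nonnegative. [cite: Kahn2022, p. 2 (Underlying independents)] -/
theorem pushWeight_nonneg {w : β → ℝ} (hw : ∀ b, 0 ≤ w b) (G : β → γ) (c : γ) :
    0 ≤ pushWeight w G c := by
  classical
  rw [pushWeight_apply]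
  exact sum_nonneg fun b _ => by split_ifs <;> simp [hw b]

/-- Each point of the source contributes its mass to the image point: `w(b) ≤ (G_* w)(G b)` for a
nonnegative weight. [cite: Kahn2022, p. 2 (Underlying independents)] -/
theorem le_pushWeight_apply {w : β → ℝ} (hw : ∀ b, 0 ≤ w b) (G : β → γ) (b : β) :
    w b ≤ pushWeight w G (G b) := by
  classical
  rw [pushWeight_apply]
  have h := single_le_sum (s := univ) (f := fun b' => if G b' = G b then w b' else 0)
    (fun b' _ => by split_ifs <;> simp [hw b']) (mem_univ b)
  rw [if_pos rfl] at h
  exact h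

/-- Outside the range of `G` the push-forward vanishes. [cite: Kahn2022, p. 2 (Underlying independents)] -/
theorem pushWeight_eq_zero_of_forall_ne (w : β → ℝ) {G : β → γ} {c : γ} (hc : ∀ b, G b ≠ c) :
    pushWeight w G c = 0 := by
  classical
  rw [pushWeight_apply]
  exact sum_eq_zero fun b _ => if_neg (hc b)

/-- On the range of an INJECTIVE map the push-forward is the original weight (zero extension).
[cite: Kahn2022, p. 2 (Underlying independents)] -/
theorem pushWeight_apply_of_injective (w : β → ℝ) {G : β → γ} (hG : Function.Injective G) (b : β) :
    pushWeight w G (G b) = w b := by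
  classical
  rw [pushWeight_apply]
  have h : ∀ b', (G b' = G b) ↔ (b' = b) := fun b' => hG.eq_iff
  simp_rw [h]
  rw [sum_ite_eq', if_pos (mem_univ _)]

/-- Push-forward along a bijection is relabelling: `(e_* w)(c) = w(e⁻¹ c)`.
[cite: Kahn2022, p. 2 (Underlying independents)] -/
theorem pushWeight_equiv (w : β → ℝ) (e : β ≃ γ) (c : γ) : pushWeight w e c = w (e.symm c) := by
  rw [← e.apply_symm_apply c, pushWeight_apply_of_injective w e.injective, e.apply_symm_apply]

/-- **Functoriality**: `H_* (G_* w) = (H ∘ G)_* w`. [cite: Kahn2022, p. 2 (Underlying independents)] -/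
theorem pushWeight_pushWeight [Fintype γ] (w : β → ℝ) (G : β → γ) (H : γ → δ) :
    pushWeight (pushWeight w G) H = pushWeight w (H ∘ G) := by
  classical
  funext d
  rw [pushWeight_eq_ex, ex_pushWeight, pushWeight_eq_ex]
  rfl

/-- Push-forward along the identity. [cite: Kahn2022, p. 2 (Underlying independents)] -/
theorem pushWeight_id (w : β → ℝ) : pushWeight w id = w := by
  funext b
  exact pushWeight_apply_of_injective w Function.injective_id b

/-- **`E_n` of a push-forward is `E_n` of the pulled-back functions**:
`E_n^{G_* w}(f_0,…,f_{n-1}) = E_n^{w}(f_0 ∘ G,…,f_{n-1} ∘ G)` — Sahi's functional only sees the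
expectations of products of the `f_i` (the Lieb–Sahi recursion).  (Same observation as
`Literature.Probability.Percolation.BHK2006.sahiE_eq_of_ex_eq`, for the explicit push-forward.)
[cite: LiebSahi2021, Def. 3.1 and Prop. 3.3; Kahn2022, p. 2 (Underlying independents)] -/
theorem sahiE_pushWeight [Fintype γ] (w : β → ℝ) (G : β → γ) :
    ∀ (n : ℕ) (f : Fin n → γ → ℝ), sahiE (pushWeight w G) n f = sahiE w n (fun i => f i ∘ G)
  | 0, f => by rw [sahiE_zero, sahiE_zero]
  | 1, f => by rw [sahiE_one_apply, sahiE_one_apply, ex_pushWeight]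
  | n + 2, f => by
    rw [sahiE_succ_succ, sahiE_succ_succ, ex_pushWeight,
      sahiE_pushWeight w G (n + 1) (Fin.tail f)]
    congr 1
    refine sum_congr rfl fun i _ => ?_
    rw [sahiE_pushWeight w G (n + 1)]
    congr 1
    funext j x
    simp only [Function.comp_apply, Function.update_apply, Fin.tail]
    split_ifs <;> rfl

/-- **Sahi positivity travels along monotone maps** (Kahn: "realize the `X_i`'s as increasing
functions of independent Bernoullis … and invoke Harris", for every order `n`): if `w` is Sahi-positive
of order `n` and `G` is monotone then so is `G_* w` (pull the monotone family back along `G`).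
[cite: Kahn2022, p. 2 (Underlying independents); LiebSahi2021, Conj. 1.1] -/
theorem SahiPositive.of_pushWeight [Fintype γ] [Preorder β] [Preorder γ] {w : β → ℝ} {n : ℕ}
    (h : SahiPositive w n) {G : β → γ} (hG : Monotone G) : SahiPositive (pushWeight w G) n := by
  intro f hf hmono
  rw [sahiE_pushWeight]
  exact h _ (fun i x => hf i (G x)) (fun i => (hmono i).comp hG)

/-- **The FKG lattice condition survives zero extension along a lattice embedding**: if `E` is
injective and preserves `⊓` and `⊔`, the push-forward (= extension by `0` off the range) of an FKG
probability weight is an FKG probability weight. [cite: Kahn2022, p. 1 eq. (1) (positive lattice condition); FortuinKasteleynGinibreCMP1971, eq. (1)] -/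
theorem isFKGMeasure_pushWeight [Fintype γ] [Lattice β] [Lattice γ] {μ : β → ℝ} (hμ : IsFKGMeasure μ)
    {E : β → γ} (hE : Function.Injective E) (hinf : ∀ a b, E (a ⊓ b) = E a ⊓ E b)
    (hsup : ∀ a b, E (a ⊔ b) = E a ⊔ E b) : IsFKGMeasure (pushWeight μ E) where
  nonneg c := pushWeight_nonneg hμ.nonneg E c
  sum_eq_one := by rw [sum_pushWeight, hμ.sum_eq_one]
  mul_le_mul x y := by
    have h0 : ∀ c, 0 ≤ pushWeight μ E c := fun c => pushWeight_nonneg hμ.nonneg E c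
    by_cases hx : ∃ a, E a = x
    · by_cases hy : ∃ b, E b = y
      · obtain ⟨a, rfl⟩ := hx
        obtain ⟨b, rfl⟩ := hy
        rw [← hinf, ← hsup, pushWeight_apply_of_injective μ hE, pushWeight_apply_of_injective μ hE,
          pushWeight_apply_of_injective μ hE, pushWeight_apply_of_injective μ hE]
        exact hμ.mul_le_mul a b
      · rw [pushWeight_eq_zero_of_forall_ne μ (fun b hb => hy ⟨b, hb⟩), mul_zero]
        exact mul_nonneg (h0 _) (h0 _)
    · rw [pushWeight_eq_zero_of_forall_ne μ (fun a ha => hx ⟨a, ha⟩), zero_mul]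
      exact mul_nonneg (h0 _) (h0 _)

end PushForward

/-! ### Coin (product) weights on the cube `ι → Bool` -/

section Coin

variable {ι : Type*} [Fintype ι]

/-- The **product weight of independent coins** with `P(Y_i = 1) = q_i` on the cube `ι → Bool`:
`Π_i (q_i if y_i else 1 − q_i)` — Sahi's product measure `μ(S) = Π_{x∈S} m_x Π_{y∉S}(1 − m_y)` in
Boolean coordinates; Kahn's "independent (nonidentical) Bernoullis".
[cite: Sahi2008, eq. (2) (p. 210); Kahn2022, p. 2 footnote 1] -/
def coinWeight (q : ι → ℝ) (y : ι → Bool) : ℝ := ∏ i, if y i then q i else 1 - q i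

/-- Non-degenerate coins give every point of the cube positive mass. [cite: Sahi2008, eq. (2) (p. 210)] -/
theorem coinWeight_pos {q : ι → ℝ} (hq : ∀ i, 0 < q i ∧ q i < 1) (y : ι → Bool) :
    0 < coinWeight q y :=
  prod_pos fun i _ => by
    split_ifs
    · exact (hq i).1
    · exact sub_pos.2 (hq i).2

/-- Coin weights are nonnegative for `q ∈ [0,1]^ι`. [cite: Sahi2008, eq. (2) (p. 210)] -/
theorem coinWeight_nonneg {q : ι → ℝ} (hq : ∀ i, 0 ≤ q i ∧ q i ≤ 1) (y : ι → Bool) :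
    0 ≤ coinWeight q y :=
  prod_nonneg fun i _ => by
    split_ifs
    · exact (hq i).1
    · exact sub_nonneg.2 (hq i).2

variable [DecidableEq ι]

/-- Fubini on the cube: `Σ_y Π_i F_i(y_i) = Π_i (F_i(1) + F_i(0))` (plumbing). [folklore] -/
private theorem sum_prod_bool (F : ι → Bool → ℝ) :
    ∑ y : ι → Bool, ∏ i, F i (y i) = ∏ i, (F i true + F i false) := by
  have h := prod_univ_sum (fun _ : ι => (univ : Finset Bool)) F
  rw [Fintype.piFinset_univ] at h
  rw [← h]
  exact prod_congr rfl fun i _ => Fintype.sum_bool _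

/-- Coin weights have total mass `1`. [cite: Sahi2008, eq. (2) (p. 210)] -/
theorem sum_coinWeight (q : ι → ℝ) : ∑ y, coinWeight q y = 1 := by
  have h := sum_prod_bool (fun i b => if b then q i else 1 - q i)
  simp only [Bool.false_eq_true, ↓reduceIte, add_sub_cancel, prod_const_one] at h
  exact h

/-- **Marginals of the coin weight**: the event "`Y_i = 1` for all `i ∈ S`" has probability
`Π_{i∈S} q_i`. [cite: Sahi2008, eq. (2) (p. 210); Kahn2022, p. 2 footnote 1 (b)] -/
theorem sum_coinWeight_forall (q : ι → ℝ) (S : Finset ι) :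
    ∑ y, (if ∀ i ∈ S, y i = true then coinWeight q y else 0) = ∏ i ∈ S, q i := by
  have h := sum_prod_bool
    (fun i b => (if b then q i else 1 - q i) * (if i ∈ S then (if b then 1 else 0) else 1))
  have hF : ∀ y : ι → Bool,
      (∏ i, (if y i then q i else 1 - q i) * (if i ∈ S then (if y i then (1 : ℝ) else 0) else 1)) =
        if ∀ i ∈ S, y i = true then coinWeight q y else 0 := by
    intro y
    rw [prod_mul_distrib, Fintype.prod_ite_mem, prod_boole]
    unfold coinWeight
    split_ifs <;> simp
  simp only [hF] at h
  rw [h, ← Fintype.prod_ite_mem S q]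
  refine prod_congr rfl fun i _ => ?_
  by_cases hi : i ∈ S <;> simp [hi]

/-- Coins in two blocks: the weight of an appended configuration is the product of the block
weights. [cite: Sahi2008, eq. (2) (p. 210)] -/
theorem coinWeight_append {m r : ℕ} (q₁ : Fin m → ℝ) (q₂ : Fin r → ℝ) (y₁ : Fin m → Bool)
    (y₂ : Fin r → Bool) :
    coinWeight (Fin.append q₁ q₂) (Fin.append y₁ y₂) = coinWeight q₁ y₁ * coinWeight q₂ y₂ := by
  unfold coinWeight
  rw [Fin.prod_univ_add]
  simp only [Fin.append_left, Fin.append_right]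

/-- Appended non-degenerate coin vectors are non-degenerate. [cite: Sahi2008, eq. (2) (p. 210)] -/
theorem append_mem_Ioo {m r : ℕ} {q₁ : Fin m → ℝ} {q₂ : Fin r → ℝ}
    (h₁ : ∀ i, 0 < q₁ i ∧ q₁ i < 1) (h₂ : ∀ i, 0 < q₂ i ∧ q₂ i < 1) :
    ∀ i, 0 < Fin.append q₁ q₂ i ∧ Fin.append q₁ q₂ i < 1 := by
  intro i
  refine Fin.addCases (fun j => ?_) (fun j => ?_) i
  · rw [Fin.append_left]; exact h₁ j
  · rw [Fin.append_right]; exact h₂ j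

end Coin

/-! ### Threshold coins: realising finitely many probabilities by nested "all heads" events -/

section Threshold

/-- The DECREASING enumeration `v_0 > v_1 > ⋯ > v_{|C|-1}` of a finite set of reals, as an
`ℕ`-indexed function (junk value `0` from `|C|` on). [cite: Kahn2022, p. 2 footnote 1 (b)] -/
def decEnum (C : Finset ℝ) (j : ℕ) : ℝ :=
  if h : j < C.card then C.orderEmbOfFin rfl (Fin.rev ⟨j, h⟩) else 0

/-- Values of the enumeration lie in `C`. [cite: Kahn2022, p. 2 footnote 1 (b)] -/
theorem decEnum_mem (C : Finset ℝ) {j : ℕ} (hj : j < C.card) : decEnum C j ∈ C := by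
  rw [decEnum, dif_pos hj]
  exact orderEmbOfFin_mem C rfl _

/-- The enumeration is strictly decreasing on `[0, |C|)`. [cite: Kahn2022, p. 2 footnote 1 (b)] -/
theorem decEnum_lt_decEnum (C : Finset ℝ) {i j : ℕ} (hij : i < j) (hj : j < C.card) :
    decEnum C j < decEnum C i := by
  have hi : i < C.card := lt_trans hij hj
  rw [decEnum, dif_pos hj, decEnum, dif_pos hi]
  exact (C.orderEmbOfFin rfl).strictMono (Fin.rev_lt_rev.2 (Fin.mk_lt_mk.2 hij))

/-- On `[0, |C|)`: `v_j ≤ v_i ↔ i ≤ j`. [cite: Kahn2022, p. 2 footnote 1 (b)] -/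
theorem decEnum_le_decEnum_iff (C : Finset ℝ) {i j : ℕ} (hi : i < C.card) (hj : j < C.card) :
    decEnum C j ≤ decEnum C i ↔ i ≤ j := by
  constructor
  · intro h
    by_contra hji
    exact absurd h (not_le.2 (decEnum_lt_decEnum C (not_le.1 hji) hi))
  · intro h
    rcases h.eq_or_lt with rfl | hlt
    · exact le_rfl
    · exact (decEnum_lt_decEnum C hlt hj).le

/-- Every element of `C` is enumerated. [cite: Kahn2022, p. 2 footnote 1 (b)] -/
theorem exists_decEnum_eq (C : Finset ℝ) {c : ℝ} (hc : c ∈ C) : ∃ j < C.card, decEnum C j = c := by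
  have hc' : c ∈ Set.range (C.orderEmbOfFin rfl) := by rw [range_orderEmbOfFin]; exact hc
  obtain ⟨i, hi⟩ := hc'
  refine ⟨(Fin.rev i : ℕ), (Fin.rev i).2, ?_⟩
  rw [decEnum, dif_pos (Fin.rev i).2]
  have : (⟨(Fin.rev i : ℕ), (Fin.rev i).2⟩ : Fin C.card) = Fin.rev i := rfl
  rw [this, Fin.rev_rev, hi]

/-- The **ratio coins** of a sequence of values: `q_0 = v_0`, `q_{j+1} = v_{j+1}/v_j`.
[cite: Kahn2022, p. 2 footnote 1 (b)] -/
def ratioCoin (v : ℕ → ℝ) : ℕ → ℝ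
  | 0 => v 0
  | j + 1 => v (j + 1) / v j

/-- Telescoping: `Π_{i ≤ j} q_i = v_j` as long as the earlier values are nonzero.
[cite: Kahn2022, p. 2 footnote 1 (b)] -/
theorem prod_range_ratioCoin (v : ℕ → ℝ) {r : ℕ} (hv : ∀ j < r, v j ≠ 0) :
    ∀ j < r, ∏ i ∈ range (j + 1), ratioCoin v i = v j := by
  intro j
  induction j with
  | zero => intro _; simp [ratioCoin]
  | succ j ih =>
    intro hj
    rw [prod_range_succ, ih (by omega), ratioCoin, mul_div_assoc', mul_div_cancel_left₀ _ (hv j (by omega))]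

/-- For a strictly decreasing sequence of values in `(0,1)` the ratio coins are non-degenerate.
[cite: Kahn2022, p. 2 footnote 1 (b)] -/
theorem ratioCoin_mem_Ioo (v : ℕ → ℝ) {r : ℕ} (h0 : ∀ j < r, 0 < v j) (h1 : ∀ j < r, v j < 1)
    (hanti : ∀ i j, i < j → j < r → v j < v i) : ∀ j < r, 0 < ratioCoin v j ∧ ratioCoin v j < 1 := by
  intro j hj
  cases j with
  | zero => exact ⟨h0 0 hj, h1 0 hj⟩
  | succ j =>
    have hvj : 0 < v j := h0 j (by omega)
    refine ⟨div_pos (h0 _ hj) hvj, (div_lt_one hvj).2 (hanti j (j + 1) (by omega) hj)⟩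

/-- **Nested "all heads" events realise the values**: on the cube `Fin r → Bool` with the ratio coins,
the increasing event "`Y_i = 1` for all `i ≤ j`" has probability exactly `v_j` (`j < r`).
[cite: Kahn2022, p. 2 footnote 1 (b)] -/
theorem sum_coinWeight_prefix (v : ℕ → ℝ) {r : ℕ} (hv : ∀ j < r, v j ≠ 0) {j : ℕ} (hj : j < r) :
    ∑ y : Fin r → Bool,
        (if ∀ i : Fin r, (i : ℕ) ≤ j → y i = true then coinWeight (fun i : Fin r => ratioCoin v i) y
          else 0) = v j := by
  classical
  have h := sum_coinWeight_forall (fun i : Fin r => ratioCoin v i) (univ.filter fun i : Fin r => (i : ℕ) ≤ j)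
  have hiff : ∀ y : Fin r → Bool, (∀ i ∈ univ.filter (fun i : Fin r => (i : ℕ) ≤ j), y i = true) ↔
      ∀ i : Fin r, (i : ℕ) ≤ j → y i = true := fun y => by simp
  simp only [hiff] at h
  rw [h, prod_filter, Fin.prod_univ_eq_prod_range (fun i => if i ≤ j then ratioCoin v i else 1) r,
    ← prod_filter]
  have hrange : (range r).filter (fun i => i ≤ j) = range (j + 1) := by
    ext i
    simp only [mem_filter, mem_range]
    omega
  rw [hrange]
  exact prod_range_ratioCoin v hv j hj

end Threshold

/-! ### Push-forward along lattice homomorphisms: monotone coarsening (Fallat et al. 2017, Prop. 3.2 / 3.4 (iii))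

Source: S. Fallat, S. Lauritzen, K. Sadeghi, C. Uhler, N. Wermuth, P. Zwiernik, *Total positivity in Markov structures*,
Ann. Statist. **45** (2017) 1152–1184 [FallatEtAl2017], §3 (held text `paper:arxiv-1510.01290`, chunk 6), verbatim:
"**Proposition 3.2.** Let `X` be a random vector taking values in `𝒳` as before. For `A ⊆ V`, let `φ = (φ_v, v ∈ V)`
be such that `φ_v : 𝒳_v → ℝ` is piecewise constant and non-decreasing for all `v ∈ A` and `φ_v(x_v) = x_v` for
`v ∉ A`. If the distribution of `X` is MTP₂, then the distribution of `Y = φ(X)` is MTP₂."  (Proof there: the fibres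
satisfy `φ⁻¹(y¹) ∧ φ⁻¹(y²) = φ⁻¹(y¹ ∧ y²)`, `φ⁻¹(y¹) ∨ φ⁻¹(y²) = φ⁻¹(y¹ ∨ y²)`, "Hence, we can apply [KarlinRinott80]".)
"**Proposition 3.4.** The MTP₂ property is closed under conditioning, marginalization, and monotone coarsening. …
(iii) If `X` is MTP₂ and discrete, and `Y` is obtained from `X` by monotone coarsening, then `Y` is MTP₂."
Here, for FINITE lattices: the push-forward of an FKG probability weight along any map preserving `⊓` and `⊔` (in
particular along a coordinatewise non-decreasing map between finite products of chains — a monotone coarsening, or a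
marginalisation followed by relabelling) is an FKG probability weight; the inequality is the four functions theorem of
Ahlswede–Daykin (Mathlib `four_functions_theorem`) applied to `μ` on the two fibres. -/

section Coarsening

open scoped FinsetFamily

variable {β γ : Type*} [Fintype β]

/-- **FKG weights push forward along maps preserving `⊓` and `⊔`** (finite distributive source lattice): the fibres
`G⁻¹{x} ⊼ G⁻¹{y} ⊆ G⁻¹{x ⊓ y}`, `G⁻¹{x} ⊻ G⁻¹{y} ⊆ G⁻¹{x ⊔ y}`, and the four functions theorem with all four
functions equal to `μ` gives `(G_*μ)(x) (G_*μ)(y) ≤ (G_*μ)(x ⊓ y) (G_*μ)(x ⊔ y)`.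
[cite: FallatEtAl2017, Prop. 3.2 (proof) and Prop. 3.4 (iii)] -/
theorem isFKGMeasure_pushWeight_of_map_inf_sup [Fintype γ] [DecidableEq β] [DistribLattice β] [Lattice γ]
    {μ : β → ℝ} (hμ : IsFKGMeasure μ) {G : β → γ} (hinf : ∀ a b, G (a ⊓ b) = G a ⊓ G b)
    (hsup : ∀ a b, G (a ⊔ b) = G a ⊔ G b) : IsFKGMeasure (pushWeight μ G) where
  nonneg c := pushWeight_nonneg hμ.nonneg G c
  sum_eq_one := by rw [sum_pushWeight, hμ.sum_eq_one]
  mul_le_mul x y := by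
    classical
    have hfib : ∀ c : γ, pushWeight μ G c = ∑ b ∈ univ.filter (fun b => G b = c), μ b := fun c => by
      rw [pushWeight, sum_filter]
    have h0 : (0 : β → ℝ) ≤ μ := fun b => hμ.nonneg b
    have h4 := four_functions_theorem μ μ μ μ h0 h0 h0 h0 hμ.mul_le_mul
      (univ.filter fun b => G b = x) (univ.filter fun b => G b = y)
    have hsub₁ : (univ.filter fun b => G b = x) ⊼ (univ.filter fun b => G b = y) ⊆
        univ.filter fun b => G b = x ⊓ y := by
      intro b hb
      rw [mem_infs] at hb
      obtain ⟨a, ha, c, hc, rfl⟩ := hb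
      rw [mem_filter] at ha hc ⊢
      exact ⟨mem_univ _, by rw [hinf, ha.2, hc.2]⟩
    have hsub₂ : (univ.filter fun b => G b = x) ⊻ (univ.filter fun b => G b = y) ⊆
        univ.filter fun b => G b = x ⊔ y := by
      intro b hb
      rw [mem_sups] at hb
      obtain ⟨a, ha, c, hc, rfl⟩ := hb
      rw [mem_filter] at ha hc ⊢
      exact ⟨mem_univ _, by rw [hsup, ha.2, hc.2]⟩
    have h5 : ∑ b ∈ (univ.filter fun b => G b = x) ⊼ (univ.filter fun b => G b = y), μ b ≤
        pushWeight μ G (x ⊓ y) := by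
      rw [hfib]; exact sum_le_sum_of_subset_of_nonneg hsub₁ fun b _ _ => hμ.nonneg b
    have h6 : ∑ b ∈ (univ.filter fun b => G b = x) ⊻ (univ.filter fun b => G b = y), μ b ≤
        pushWeight μ G (x ⊔ y) := by
      rw [hfib]; exact sum_le_sum_of_subset_of_nonneg hsub₂ fun b _ _ => hμ.nonneg b
    rw [hfib x, hfib y]
    exact h4.trans (mul_le_mul h5 h6 (sum_nonneg fun b _ => hμ.nonneg b) (pushWeight_nonneg hμ.nonneg G _))

/-- **Monotone coarsening on products of chains** [FallatEtAl2017, Prop. 3.2 / 3.4 (iii)]: if `φ i : α i → γ i` is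
non-decreasing for every coordinate `i`, the law of `(φ i (X i))_i` under an FKG probability weight is an FKG
probability weight (coordinatewise non-decreasing maps of chains preserve `⊓` and `⊔`).
[cite: FallatEtAl2017, Prop. 3.2 and Prop. 3.4 (iii)] -/
theorem isFKGMeasure_pushWeight_of_monotone {ι : Type*} [Fintype ι] [DecidableEq ι] {α γ : ι → Type*}
    [∀ i, LinearOrder (α i)] [∀ i, Fintype (α i)] [∀ i, LinearOrder (γ i)] [∀ i, Fintype (γ i)]
    {μ : (∀ i, α i) → ℝ} (hμ : IsFKGMeasure μ) (φ : ∀ i, α i → γ i) (hφ : ∀ i, Monotone (φ i)) :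
    IsFKGMeasure (pushWeight μ fun x i => φ i (x i)) := by
  classical
  refine isFKGMeasure_pushWeight_of_map_inf_sup hμ (fun a b => ?_) (fun a b => ?_)
  · funext i; rw [Pi.inf_apply, Pi.inf_apply]; exact (hφ i).map_inf _ _
  · funext i; rw [Pi.sup_apply, Pi.sup_apply]; exact (hφ i).map_sup _ _

end Coarsening


end Literature.Combinatorics.Sahi2008
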